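import Literature.AnabelianGeometry.SemiGraphs.ProSigmaFreeFactorEngine
import Literature.AnabelianGeometry.SemiGraphs.ProSigmaCompletionProfiniteExtend
import HarnessLib

/-!
# Free-factor malnormality in pro-`Σ` completions, III: the theorem

Ribes–Zalesskii, *Profinite Groups* (2nd ed.), Thm. 9.1.12 [cite: RibesZalesskii2010, Thm. 9.1.12],
specialised to free pro-`Σ` GROUPS and proved WITHOUT the Kurosh subgroup theorem (parts I/II:
`ProSigmaFreeFactorLifting.lean`, `ProSigmaFreeFactorEngine.lean`).  Setting: `Γ` a free group with
basis `b : β → Γ`, `S ⊆ β`, `ι : Γ → P` a pro-`Σ` completion (`IsProSigmaCompletion`, `P` profinite), and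

  `A := closure ι⟨b(S)⟩ = ((Subgroup.closure (b '' S)).map ι).topologicalClosure`,

the closed subgroup generated by part of the basis (the closure of the free factor `Γ_S = ⟨b(S)⟩`).

* `freeFactor_eq_one_of_conj_mem` — if `x ∉ A`, `z ∈ A` and `x z x⁻¹ ∈ A` then `z = 1`;
* `freeFactor_eq_one_of_commute` — if `x ∉ A` commutes with `y ∈ A` then `y = 1` (centralisers of
  non-trivial elements of `A` lie in `A`);
* `freeFactor_inf_conj_eq_bot` — **malnormality**: `A ∩ x A x⁻¹ = 1` for every `x ∉ A`;
* `mem_freeFactor_of_inf_conj_ne_bot` — membership form.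

These generalise the rank-one engine `closure_zpowers_inf_conj_eq_bot` (`S = {i}`,
`ProSigmaCompletionMalnormal.lean`) and are the group-theoretic input "(M)" of the verticial clauses of
[CombGC] Prop. 1.2 / 1.5 at genuine MULTI-vertex pointed stable curves (verticial subgroups are closures of
free factors of rank `≥ 2` of the discrete fundamental group).

Route.  Let `ρ̂ : P → P` be the continuous retraction extending `ρ` (`b_s ↦ b_s`, `b_t ↦ 1`;
`exists_continuous_extend_profinite`); it fixes `A` pointwise and has image in `A`
(`freeFactor_retract_apply`).  For `x ∉ A` put `a = ρ̂ x ∈ A` and `k = a⁻¹x ∈ Ker ρ̂ ∖ 1`; if `z` and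
`x z x⁻¹` lie in `A`, then `k z k⁻¹ = a⁻¹(x z x⁻¹)a ∈ A` has `ρ̂`-image `z`, so `k` commutes with `z`.
The core `freeFactor_eq_one_of_commute_of_retract_eq_one`: if `k ∈ Ker ρ̂ ∖ 1` commutes with
`y ∈ A ∖ 1`, pick `U ⊴ P` open normal with `y ∉ U`, `C = closure⟨y⟩`, and the open subgroup
`H = ρ̂⁻¹(U·C) ∋ k, y`; then `A ∩ H = (A ∩ U)·C`, so `(A ∩ H)/(A ∩ H ∩ U)` is a finite ABELIAN `Σ`-group
in which `y ↦ ȳ ≠ 1`, and the engine of part II yields the contradiction.  Theorems only; classical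
profinite group theory; nothing here takes a side on [IUTchIII] Cor. 3.12.
-/

namespace Literature.AnabelianGeometry.SemiGraphs.SemiGraphOfAnabelioids.IsProSigmaCompletion

open Literature.AnabelianGeometry.Anabelioids Topology
open scoped Pointwise

variable {Sigma : Set ℕ} {Γ : Type*} [Group Γ] {P : Type*} [Group P] [TopologicalSpace P]
  [IsTopologicalGroup P] [CompactSpace P] [TotallyDisconnectedSpace P] {ι : Γ →* P}

/-! ### The retraction `ρ̂` and the reduction to `Ker ρ̂` -/

omit [CompactSpace P] [TotallyDisconnectedSpace P] in
/-- A continuous `ρ̂ : P → P` with `ρ̂ ∘ ι = ι ∘ ρ` fixes `A = closure ι(Γ_S)` pointwise and takes values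
in `A`. [cite: RibesZalesskii2010, Thm. 9.1.12] -/
theorem freeFactor_retract_apply [T2Space P] {β : Type*} (b : FreeGroupBasis β Γ) (S : Set β)
    [DecidablePred (· ∈ S)] (ρ : Γ →* Γ) (hρ : ∀ j, ρ (b j) = if j ∈ S then b j else 1)
    (hι : IsProSigmaCompletion Sigma ι) (A : Subgroup P)
    (hA : A = ((Subgroup.closure (b '' S)).map ι).topologicalClosure) (ρh : P →* P)
    (hρhc : Continuous ρh) (hρhι : ∀ γ, ρh (ι γ) = ι (ρ γ)) :
    (∀ a, a ∈ A → ρh a = a) ∧ ∀ z, ρh z ∈ A := by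
  obtain ⟨hρS, hρid, -⟩ := retract_mem_closure b S ρ hρ
  subst hA
  constructor
  · have hle : ((Subgroup.closure (b '' S)).map ι).topologicalClosure ≤
        ρh.eqLocus (MonoidHom.id P) := by
      refine Subgroup.topologicalClosure_minimal _ ?_ (isClosed_eq hρhc continuous_id)
      rintro _ ⟨d, hd, rfl⟩
      change ρh (ι d) = ι d
      rw [hρhι, hρid d hd]
    exact fun a ha => hle ha
  · have hcl : IsClosed (((((Subgroup.closure (b '' S)).map ι).topologicalClosure).comap ρh :
        Subgroup P) : Set P) :=
      (Subgroup.isClosed_topologicalClosure _).preimage hρhc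
    have hsub : Set.range ι ⊆ (((((Subgroup.closure (b '' S)).map ι).topologicalClosure).comap ρh :
        Subgroup P) : Set P) := by
      rintro _ ⟨γ, rfl⟩
      change ρh (ι γ) ∈ ((Subgroup.closure (b '' S)).map ι).topologicalClosure
      rw [hρhι]
      exact Subgroup.le_topologicalClosure _ ⟨ρ γ, hρS γ, rfl⟩
    have huniv := hcl.closure_subset_iff.mpr hsub
    rw [hι.dense.closure_eq] at huniv
    exact fun z => huniv (Set.mem_univ z)

/-- **The core.**  With `ρ̂` a continuous retraction as above (`ρ̂ ∘ ι = ι ∘ ρ`): if `k ∈ Ker ρ̂`,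
`k ≠ 1`, commutes with `y ∈ A = closure ι(Γ_S)`, then `y = 1`.  (If `y ≠ 1`: `U ⊴ P` open normal with
`y ∉ U`, `C = closure⟨y⟩`, `H = ρ̂⁻¹(U C)`; `(A ∩ H)/(A ∩ H ∩ U)` is finite abelian (it is generated by
the image of `C`), `Σ`, and sees `y`; apply `freeFactor_false_of_commute_of_character`.)
[cite: RibesZalesskii2010, Thm. 9.1.12] -/
theorem freeFactor_eq_one_of_commute_of_retract_eq_one [T2Space P] {β : Type*}
    (b : FreeGroupBasis β Γ) (S : Set β) [DecidablePred (· ∈ S)] (ρ : Γ →* Γ)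
    (hρ : ∀ j, ρ (b j) = if j ∈ S then b j else 1) (hι : IsProSigmaCompletion Sigma ι)
    (A : Subgroup P) (hA : A = ((Subgroup.closure (b '' S)).map ι).topologicalClosure)
    (ρh : P →* P) (hρhc : Continuous ρh) (hρhι : ∀ γ, ρh (ι γ) = ι (ρ γ)) {k y : P}
    (hk : ρh k = 1) (hk1 : k ≠ 1) (hy : y ∈ A) (hc : Commute k y) : y = 1 := by
  classical
  obtain ⟨-, -, hρρ⟩ := retract_mem_closure b S ρ hρ
  obtain ⟨hρhA, -⟩ := freeFactor_retract_apply b S ρ hρ hι A hA ρh hρhc hρhι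
  have hAc : IsClosed (A : Set P) := by
    rw [hA]
    exact Subgroup.isClosed_topologicalClosure _
  have hkA : k ∉ A := fun h => hk1 (by rw [← hρhA k h, hk])
  by_contra hy1
  -- an open normal `U` missing `y`
  obtain ⟨U, hU⟩ := ProfiniteGrp.exist_openNormalSubgroup_sub_open_nhds_of_one
    (isOpen_compl_singleton (x := y)) (show (1 : P) ∈ ({y}ᶜ : Set P) from fun h => hy1 h.symm)
  have hyU : y ∉ (U : Subgroup P) := fun h => hU h rfl
  haveI : (U : Subgroup P).Normal := U.isNormal'
  -- `C = closure ⟨y⟩ ≤ A`, commutative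
  let C : Subgroup P := (Subgroup.zpowers y).topologicalClosure
  have hyC : y ∈ C := Subgroup.le_topologicalClosure _ (Subgroup.mem_zpowers y)
  have hCcomm : ∀ c ∈ C, ∀ c' ∈ C, c * c' = c' * c := by
    have hs : ∀ u v : Subgroup.zpowers y, u * v = v * u := by
      rintro ⟨u, i, rfl⟩ ⟨v, j, rfl⟩
      exact Subtype.ext (Commute.zpow_zpow_self y i j).eq
    letI := (Subgroup.zpowers y).commGroupTopologicalClosure hs
    intro c hc c' hc'
    exact congrArg Subtype.val (mul_comm (⟨c, hc⟩ : C) ⟨c', hc'⟩)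
  -- `V = U · C` (open) and `H = ρ̂⁻¹ V`
  let V : Subgroup P := (U : Subgroup P) ⊔ C
  have hVo : IsOpen (V : Set P) := Subgroup.isOpen_mono le_sup_left U.isOpen'
  have hVcoe : (V : Set P) = ((U : Subgroup P) : Set P) * (C : Set P) :=
    Subgroup.normal_mul (U : Subgroup P) C
  let H : Subgroup P := V.comap ρh
  have hHo : IsOpen (H : Set P) := hVo.preimage hρhc
  have hHρ : ∀ γ, ι γ ∈ H ↔ ι (ρ γ) ∈ H := by
    intro γ
    change ρh (ι γ) ∈ V ↔ ρh (ι (ρ γ)) ∈ V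
    rw [hρhι, hρhι, hρρ]
  have hkH : k ∈ H := by
    change ρh k ∈ V
    rw [hk]
    exact V.one_mem
  have hyH : y ∈ H := by
    change ρh y ∈ V
    rw [hρhA y hy]
    exact Subgroup.mem_sup_right hyC
  -- `K = A ∩ H`; `K ⊆ V`
  let K : Subgroup P := A ⊓ H
  have hKV : ∀ z, z ∈ K → z ∈ V := fun z hz => by
    have h := hz.2
    change ρh z ∈ V at h
    rwa [hρhA z hz.1] at h
  have hKc : IsClosed (K : Set P) := hAc.inter (H.isClosed_of_isOpen hHo)
  haveI : CompactSpace K := isCompact_iff_compactSpace.mp hKc.isCompact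
  -- the character `χ : K → K/(K ∩ U)`
  let UK : Subgroup K := (U : Subgroup P).subgroupOf K
  haveI : UK.Normal := (U.isNormal').subgroupOf K
  have hUKo : IsOpen (UK : Set K) := Subgroup.subgroupOf_isOpen K (U : Subgroup P) U.isOpen'
  haveI : Finite (K ⧸ UK) := Subgroup.quotient_finite_of_isOpen UK hUKo
  haveI : DiscreteTopology (K ⧸ UK) := QuotientGroup.discreteTopology hUKo
  let q : P →* P ⧸ (U : Subgroup P) := QuotientGroup.mk' (U : Subgroup P)
  have hqK : ∀ z : K, ∃ c ∈ C, q (z : P) = q c := by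
    intro z
    obtain ⟨u, hu, c, hc, huc⟩ := Set.mem_mul.mp (hVcoe ▸ hKV z z.2 : (z : P) ∈ ((U : Subgroup P) : Set P) * (C : Set P))
    refine ⟨c, hc, ?_⟩
    have hqu : q u = 1 := (QuotientGroup.eq_one_iff u).mpr hu
    rw [← huc, map_mul, hqu, one_mul]
  have hcommK : ∀ u v : K ⧸ UK, u * v = v * u := by
    intro u v
    induction u using QuotientGroup.induction_on with
    | H u =>
    induction v using QuotientGroup.induction_on with
    | H v =>
    rw [← QuotientGroup.mk_mul, ← QuotientGroup.mk_mul, QuotientGroup.eq]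
    change (((u * v)⁻¹ * (v * u) : K) : P) ∈ (U : Subgroup P)
    obtain ⟨c, hc, huc⟩ := hqK u
    obtain ⟨c', hc', hvc⟩ := hqK v
    have key : q (((u * v)⁻¹ * (v * u) : K) : P) = 1 := by
      simp only [Subgroup.coe_mul, Subgroup.coe_inv, map_mul, map_inv, huc, hvc]
      rw [← map_mul, ← map_mul, hCcomm c hc c' hc', ← map_inv, ← map_mul, inv_mul_cancel, map_one]
    have key' : (QuotientGroup.mk (((u * v)⁻¹ * (v * u) : K) : P) : P ⧸ (U : Subgroup P)) = 1 := key
    exact (QuotientGroup.eq_one_iff _).mp key'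
  have hMσ : IsSigmaInteger Sigma (Nat.card (K ⧸ UK)) := by
    rw [← Subgroup.index_eq_card]
    exact (hι.index_open _ U.isNormal' U.isOpen').of_dvd
      (Subgroup.relIndex_dvd_index_of_normal (U : Subgroup P) K)
  let χ : K →* K ⧸ UK := QuotientGroup.mk' UK
  have hχc : Continuous χ := QuotientGroup.continuous_mk
  have hχy : χ ⟨y, hy, hyH⟩ ≠ 1 := by
    intro h
    have h' : (QuotientGroup.mk (⟨y, hy, hyH⟩ : K) : K ⧸ UK) = 1 := h
    exact hyU (Subgroup.mem_subgroupOf.mp ((QuotientGroup.eq_one_iff _).mp h'))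
  exact freeFactor_false_of_commute_of_character b S ρ hρ hι A hA H hHo hHρ hcommK hMσ χ hχc
    ⟨hy, hyH⟩ hχy hkH hkA hc

/-! ### Malnormality of the closed subgroup generated by part of a free basis -/

/-- **Reduction to the core.**  Let `Γ` be free with basis `b : β → Γ`, `S ⊆ β`, `ι : Γ → P` a pro-`Σ`
completion (`P` profinite), `A = ((Subgroup.closure (b '' S)).map ι).topologicalClosure`.  If `x ∉ A`,
`z ∈ A` and `x z x⁻¹ ∈ A`, then `z = 1`.  (With the continuous retraction `ρ̂` and `a = ρ̂ x ∈ A`,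
`k = a⁻¹ x ∈ Ker ρ̂ ∖ 1` satisfies `k z k⁻¹ = a⁻¹ (x z x⁻¹) a ∈ A`; applying `ρ̂` gives
`a⁻¹ (x z x⁻¹) a = z`, so `k` commutes with `z` and the core applies.)
[cite: RibesZalesskii2010, Thm. 9.1.12] -/
theorem freeFactor_eq_one_of_conj_mem [T2Space P] {β : Type*} (b : FreeGroupBasis β Γ) (S : Set β)
    (hι : IsProSigmaCompletion Sigma ι) {x z : P}
    (hx : x ∉ ((Subgroup.closure (b '' S)).map ι).topologicalClosure)
    (hz : z ∈ ((Subgroup.closure (b '' S)).map ι).topologicalClosure)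
    (hxz : x * z * x⁻¹ ∈ ((Subgroup.closure (b '' S)).map ι).topologicalClosure) : z = 1 := by
  classical
  let ρ : Γ →* Γ := b.lift fun j => if j ∈ S then b j else 1
  have hρ : ∀ j, ρ (b j) = if j ∈ S then b j else 1 := fun j => b.lift_apply_basis _ j
  obtain ⟨ρh, hρhc, hρhι'⟩ := exists_continuous_extend_profinite hι hι.index_open (ι.comp ρ)
  have hρhι : ∀ γ, ρh (ι γ) = ι (ρ γ) := fun γ => hρhι' γ
  obtain ⟨hρhA, hρhmem⟩ := freeFactor_retract_apply b S ρ hρ hι _ rfl ρh hρhc hρhι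
  have haA := hρhmem x
  have hk : ρh ((ρh x)⁻¹ * x) = 1 := by
    rw [map_mul, map_inv, hρhA _ haA, inv_mul_cancel]
  have hk1 : (ρh x)⁻¹ * x ≠ 1 := by
    intro h
    rw [inv_mul_eq_one] at h
    exact hx (h ▸ haA)
  have h1 : (ρh x)⁻¹ * x * z * ((ρh x)⁻¹ * x)⁻¹ = (ρh x)⁻¹ * (x * z * x⁻¹) * ρh x := by group
  have h2 : (ρh x)⁻¹ * (x * z * x⁻¹) * ρh x = z := by
    have e1 : ρh ((ρh x)⁻¹ * x * z * ((ρh x)⁻¹ * x)⁻¹) = z := by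
      rw [map_mul, map_mul, map_inv, hk, one_mul, inv_one, mul_one, hρhA z hz]
    have e2 : ρh ((ρh x)⁻¹ * (x * z * x⁻¹) * ρh x) = (ρh x)⁻¹ * (x * z * x⁻¹) * ρh x :=
      hρhA _ (Subgroup.mul_mem _ (Subgroup.mul_mem _ (Subgroup.inv_mem _ haA) hxz) haA)
    rw [← e2, ← h1, e1]
  have hc : Commute ((ρh x)⁻¹ * x) z := by
    rw [commute_iff_eq]
    calc (ρh x)⁻¹ * x * z = (ρh x)⁻¹ * x * z * ((ρh x)⁻¹ * x)⁻¹ * ((ρh x)⁻¹ * x) := by group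
      _ = z * ((ρh x)⁻¹ * x) := by rw [h1, h2]
  exact freeFactor_eq_one_of_commute_of_retract_eq_one b S ρ hρ hι _ rfl ρh hρhc hρhι hk hk1 hz hc

/-- **Centralisers of non-trivial elements of `A = closure ι⟨b(S)⟩` lie in `A`.**  Let `Γ` be free with
basis `b : β → Γ`, `S ⊆ β`, `ι : Γ → P` a pro-`Σ` completion (`P` profinite),
`A = ((Subgroup.closure (b '' S)).map ι).topologicalClosure`.  If `x ∉ A` commutes with `y ∈ A`, then
`y = 1`. [cite: RibesZalesskii2010, Thm. 9.1.12] -/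
theorem freeFactor_eq_one_of_commute [T2Space P] {β : Type*} (b : FreeGroupBasis β Γ) (S : Set β)
    (hι : IsProSigmaCompletion Sigma ι) {x y : P}
    (hx : x ∉ ((Subgroup.closure (b '' S)).map ι).topologicalClosure)
    (hy : y ∈ ((Subgroup.closure (b '' S)).map ι).topologicalClosure) (hxy : Commute x y) :
    y = 1 :=
  freeFactor_eq_one_of_conj_mem b S hι hx hy (by rwa [hxy.eq, mul_inv_cancel_right])

/-- **Malnormality of `A = closure ι⟨b(S)⟩`** (free-factor malnormality in the pro-`Σ` completion,
Ribes–Zalesskii Thm. 9.1.12 for free pro-`Σ` groups): `A ∩ x A x⁻¹ = 1` for every `x ∉ A`.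
[cite: RibesZalesskii2010, Thm. 9.1.12] -/
theorem freeFactor_inf_conj_eq_bot [T2Space P] {β : Type*} (b : FreeGroupBasis β Γ) (S : Set β)
    (hι : IsProSigmaCompletion Sigma ι) {x : P}
    (hx : x ∉ ((Subgroup.closure (b '' S)).map ι).topologicalClosure) :
    ((Subgroup.closure (b '' S)).map ι).topologicalClosure ⊓
      ConjAct.toConjAct x • ((Subgroup.closure (b '' S)).map ι).topologicalClosure = ⊥ := by
  rw [eq_bot_iff]
  rintro z ⟨hzA, hzx⟩
  rw [Subgroup.mem_bot]
  obtain ⟨z', hz', hxz⟩ := (Subgroup.mem_smul_pointwise_iff_exists _ _ _).mp hzx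
  rw [ConjAct.toConjAct_smul] at hxz
  have hz'1 : z' = 1 := freeFactor_eq_one_of_conj_mem b S hι hx hz' (hxz ▸ hzA)
  rw [← hxz, hz'1, mul_one, mul_inv_cancel]

/-- Malnormality, membership form: if `A ∩ x A x⁻¹ ≠ 1` then `x ∈ A`.
[cite: RibesZalesskii2010, Thm. 9.1.12] -/
theorem mem_freeFactor_of_inf_conj_ne_bot [T2Space P] {β : Type*} (b : FreeGroupBasis β Γ)
    (S : Set β) (hι : IsProSigmaCompletion Sigma ι) {x : P}
    (hx : ((Subgroup.closure (b '' S)).map ι).topologicalClosure ⊓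
      ConjAct.toConjAct x • ((Subgroup.closure (b '' S)).map ι).topologicalClosure ≠ ⊥) :
    x ∈ ((Subgroup.closure (b '' S)).map ι).topologicalClosure := by
  by_contra h
  exact hx (freeFactor_inf_conj_eq_bot b S hι h)

end Literature.AnabelianGeometry.SemiGraphs.SemiGraphOfAnabelioids.IsProSigmaCompletion
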